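import Summits.QuantumFields.QCD.Theorems.HeatSlicedQuarksRobustYangMillsHandoverTransferFormsEmbed

/-!
# The two top min–max levels of the QCD transfer matrix, read off its `L²` realisation
(crux `HeatSlicedQuarks.RobustYangMillsHandover`, item stmt-QuantumFields-8892, line `pin-the-infimum`;
registered sub-goal `qcdTransferLevel_eq_embedded_levels` of the lead skeleton, `--supports stmt-QuantumFields-8892`)

`Literature/MathematicalPhysics/QuantumFieldTheory/QCDTransferMatrix.lean` defines the min–max levels
`λₙ = qcdTransferLevel N_f S β m n` of Lüscher's positive transfer matrix of lattice QCD WITHOUT operators, as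
`inf_{Φ₁…Φₙ ∈ core} sup {𝔱(Ψ,Ψ).re / 𝔫(Ψ,Ψ).re : Ψ ∈ core, 𝔫(Ψ,Ψ) ≠ 0, 𝔫(Φᵢ,Ψ) = 0}` over the core of
continuous gauge-invariant waves (`transferCore`), `𝔫 = fermionWeightForm`, `𝔱 = transferForm`.

The lead's operator realisation lives on `H = L²(ν)`, `ν = sliceHaar S ⊗ count` on `SU(3)^{Edge 3 S} × J`
(`J ≃ Finset ι` finite), through the embedding `Ψ ↦ fΨ`, `fΨ(U, j) = (R(U)Ψ(U))_{e⁻¹ j}` (`R(U)` a continuous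
Hermitian square root of `T̂_F(U)`), with the transfer operator any bounded `T` agreeing a.e. with the integral
operator of kernel `K_β(U,U') (R(U)R(U'))_{st}`.  By the two landed identities `⟪fΦ, fΨ⟫ = 𝔫(Φ, Ψ)` and
`⟪fΦ, T fΨ⟫ = 𝔱(Φ, Ψ)` (`HeatSlicedQuarksRobustYangMillsHandoverTransferFormsEmbed`), for an embedded core wave
the operator Rayleigh quotient `Re ⟪f, T f⟫ / ‖f‖²` is the form Rayleigh quotient `transferRayleigh`, `f ≠ 0` iff
`𝔫(Ψ,Ψ) ≠ 0`, and the constraint `⟪fΦ, f⟫ = 0` is `𝔫(Φ, Ψ) = 0`.  Hence (this file) `λ₀` and `λ₁` coincide with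
the same inf–sup taken over the EMBEDDED core `S₀ = {f ∈ H | ∃ Ψ ∈ core, f = fΨ a.e.}`: the image sets of reals
whose `sSup`/`sInf` are taken are literally equal.  Pure bookkeeping; no analysis beyond the landed identities.

References: M. Reed, B. Simon, *Methods of Modern Mathematical Physics IV*, Thm XIII.1 (min–max)
[ReedSimonIV1978]; J. Smit, *Introduction to Quantum Fields on a Lattice* (2023), §6.5 (6.87) [Smit2023].
-/

noncomputable section

open MeasureTheory Matrix Literature.MathematicalPhysics.QuantumFieldTheory
  Literature.MathematicalPhysics.QuantumLattice
open scoped InnerProductSpace ComplexConjugate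

namespace Summit.QuantumFields.QCD.Cruxes.RobustYangMillsHandover.PinTheInfimum

open TransferFormsEmbed (inner_embed_eq_fermionWeightForm inner_transferOp_embed_eq_transferForm)

namespace EmbeddedLevels

variable {Nf S : ℕ} [NeZero S] {β : ℝ} {mq : Fin Nf → ℝ}
  {J : Type} [Fintype J] [MeasurableSpace J] [MeasurableSingletonClass J]
  {e : Finset (SliceFermiIdx Nf S) ≃ J}
  {R : GaugeConfig 3 S (specialUnitaryGroup (Fin 3) ℂ) →
    Matrix (Finset (SliceFermiIdx Nf S)) (Finset (SliceFermiIdx Nf S)) ℂ}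

/-- `‖fΨ‖² = Re 𝔫(Ψ, Ψ)` for an embedded continuous wave. [cite: Smit2023, §6.5 (6.87)] -/
theorem norm_sq_embed (hR : Continuous R) (hRh : ∀ U, (R U)ᴴ = R U)
    (hRsq : ∀ U, R U * R U = fermionSliceOp U mq) {Ψ : SliceWave Nf S} (hΨ : Continuous Ψ)
    {f : Lp ℂ 2 ((sliceHaar S).prod (Measure.count : Measure J))}
    (hf : (f : GaugeConfig 3 S (specialUnitaryGroup (Fin 3) ℂ) × J → ℂ)
      =ᵐ[(sliceHaar S).prod (Measure.count : Measure J)] fun p => (R p.1 *ᵥ Ψ p.1) (e.symm p.2)) :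
    ‖f‖ ^ 2 = (fermionWeightForm mq Ψ Ψ).re := by
  rw [← inner_embed_eq_fermionWeightForm Nf S mq J e R hR hRh hRsq Ψ Ψ hΨ hΨ f f hf hf,
    ← RCLike.re_to_complex, inner_self_eq_norm_sq (𝕜 := ℂ)]

/-- `fΨ ≠ 0 ↔ 𝔫(Ψ, Ψ) ≠ 0` for an embedded continuous wave. [cite: Smit2023, §6.5 (6.87)] -/
theorem embed_ne_zero_iff (hR : Continuous R) (hRh : ∀ U, (R U)ᴴ = R U)
    (hRsq : ∀ U, R U * R U = fermionSliceOp U mq) {Ψ : SliceWave Nf S} (hΨ : Continuous Ψ)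
    {f : Lp ℂ 2 ((sliceHaar S).prod (Measure.count : Measure J))}
    (hf : (f : GaugeConfig 3 S (specialUnitaryGroup (Fin 3) ℂ) × J → ℂ)
      =ᵐ[(sliceHaar S).prod (Measure.count : Measure J)] fun p => (R p.1 *ᵥ Ψ p.1) (e.symm p.2)) :
    f ≠ 0 ↔ fermionWeightForm mq Ψ Ψ ≠ 0 := by
  rw [← inner_embed_eq_fermionWeightForm Nf S mq J e R hR hRh hRsq Ψ Ψ hΨ hΨ f f hf hf,
    inner_self_ne_zero]

/-- The operator Rayleigh quotient of an embedded continuous wave is the form Rayleigh quotient: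
`Re ⟪fΨ, T fΨ⟫ / ‖fΨ‖² = Re 𝔱(Ψ,Ψ) / Re 𝔫(Ψ,Ψ)`. [cite: ReedSimonIV1978, Thm XIII.1] -/
theorem rayleigh_embed (hR : Continuous R) (hRh : ∀ U, (R U)ᴴ = R U)
    (hRsq : ∀ U, R U * R U = fermionSliceOp U mq) {Ψ : SliceWave Nf S} (hΨ : Continuous Ψ)
    {f : Lp ℂ 2 ((sliceHaar S).prod (Measure.count : Measure J))}
    (hf : (f : GaugeConfig 3 S (specialUnitaryGroup (Fin 3) ℂ) × J → ℂ)
      =ᵐ[(sliceHaar S).prod (Measure.count : Measure J)] fun p => (R p.1 *ᵥ Ψ p.1) (e.symm p.2))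
    {T : Lp ℂ 2 ((sliceHaar S).prod (Measure.count : Measure J)) →L[ℂ]
      Lp ℂ 2 ((sliceHaar S).prod (Measure.count : Measure J))}
    (hT : ∀ φ : Lp ℂ 2 ((sliceHaar S).prod (Measure.count : Measure J)),
      (T φ : GaugeConfig 3 S (specialUnitaryGroup (Fin 3) ℂ) × J → ℂ)
        =ᵐ[(sliceHaar S).prod (Measure.count : Measure J)] fun p =>
          ∫ q, (gaugeSliceKernel β p.1 q.1 : ℂ) * (R p.1 * R q.1) (e.symm p.2) (e.symm q.2) * φ q
            ∂((sliceHaar S).prod (Measure.count : Measure J))) :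
    RCLike.re ⟪f, T f⟫_ℂ / ‖f‖ ^ 2 = transferRayleigh β mq Ψ := by
  rw [transferRayleigh, norm_sq_embed hR hRh hRsq hΨ hf,
    inner_transferOp_embed_eq_transferForm Nf S β mq J e R hR hRh hRsq Ψ Ψ hΨ hΨ f f hf hf T hT,
    RCLike.re_to_complex]

/-- **Transport of a constrained Rayleigh image along the embedding**: if the constraint `P` on core waves and the
constraint `Q` on vectors agree along `Ψ ↦ fΨ`, and every continuous wave embeds, then the set of form Rayleigh
quotients of the `P`-constrained non-degenerate core waves equals the set of operator Rayleigh quotients of the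
`Q`-constrained non-zero embedded core vectors. [cite: ReedSimonIV1978, Thm XIII.1] -/
theorem rayleigh_image_eq (hR : Continuous R) (hRh : ∀ U, (R U)ᴴ = R U)
    (hRsq : ∀ U, R U * R U = fermionSliceOp U mq)
    (hex : ∀ Ψ : SliceWave Nf S, Continuous Ψ →
      ∃ f : Lp ℂ 2 ((sliceHaar S).prod (Measure.count : Measure J)),
        (f : GaugeConfig 3 S (specialUnitaryGroup (Fin 3) ℂ) × J → ℂ)
          =ᵐ[(sliceHaar S).prod (Measure.count : Measure J)] fun p => (R p.1 *ᵥ Ψ p.1) (e.symm p.2))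
    {T : Lp ℂ 2 ((sliceHaar S).prod (Measure.count : Measure J)) →L[ℂ]
      Lp ℂ 2 ((sliceHaar S).prod (Measure.count : Measure J))}
    (hT : ∀ φ : Lp ℂ 2 ((sliceHaar S).prod (Measure.count : Measure J)),
      (T φ : GaugeConfig 3 S (specialUnitaryGroup (Fin 3) ℂ) × J → ℂ)
        =ᵐ[(sliceHaar S).prod (Measure.count : Measure J)] fun p =>
          ∫ q, (gaugeSliceKernel β p.1 q.1 : ℂ) * (R p.1 * R q.1) (e.symm p.2) (e.symm q.2) * φ q
            ∂((sliceHaar S).prod (Measure.count : Measure J)))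
    (P : SliceWave Nf S → Prop) (Q : Lp ℂ 2 ((sliceHaar S).prod (Measure.count : Measure J)) → Prop)
    (hPQ : ∀ Ψ ∈ transferCore Nf S, ∀ f : Lp ℂ 2 ((sliceHaar S).prod (Measure.count : Measure J)),
      (f : GaugeConfig 3 S (specialUnitaryGroup (Fin 3) ℂ) × J → ℂ)
          =ᵐ[(sliceHaar S).prod (Measure.count : Measure J)] (fun p => (R p.1 *ᵥ Ψ p.1) (e.symm p.2)) →
        (P Ψ ↔ Q f)) :
    transferRayleigh β mq '' {Ψ | Ψ ∈ transferCore Nf S ∧ fermionWeightForm mq Ψ Ψ ≠ 0 ∧ P Ψ} =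
      (fun f : Lp ℂ 2 ((sliceHaar S).prod (Measure.count : Measure J)) =>
          RCLike.re ⟪f, T f⟫_ℂ / ‖f‖ ^ 2) ''
        {f | f ∈ {f : Lp ℂ 2 ((sliceHaar S).prod (Measure.count : Measure J)) |
            ∃ Ψ ∈ transferCore Nf S, (f : GaugeConfig 3 S (specialUnitaryGroup (Fin 3) ℂ) × J → ℂ)
              =ᵐ[(sliceHaar S).prod (Measure.count : Measure J)] fun p => (R p.1 *ᵥ Ψ p.1) (e.symm p.2)} ∧
          f ≠ 0 ∧ Q f} := by
  refine Set.Subset.antisymm ?_ ?_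
  · rintro _ ⟨Ψ, ⟨hΨ, hΨn, hP⟩, rfl⟩
    obtain ⟨f, hf⟩ := hex Ψ hΨ.1
    exact ⟨f, ⟨⟨Ψ, hΨ, hf⟩, (embed_ne_zero_iff hR hRh hRsq hΨ.1 hf).2 hΨn, (hPQ Ψ hΨ f hf).1 hP⟩,
      rayleigh_embed hR hRh hRsq hΨ.1 hf hT⟩
  · rintro _ ⟨f, ⟨⟨Ψ, hΨ, hf⟩, hf0, hQ⟩, rfl⟩
    exact ⟨Ψ, ⟨hΨ, (embed_ne_zero_iff hR hRh hRsq hΨ.1 hf).1 hf0, (hPQ Ψ hΨ f hf).2 hQ⟩,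
      (rayleigh_embed hR hRh hRsq hΨ.1 hf hT).symm⟩

/-- The level-`1` instance: for a constraint vector `φ = fΦ₀` embedding a continuous wave `Φ₀`, the constrained
suprema agree, `sup {R(Ψ) : Ψ ∈ core, 𝔫(Ψ,Ψ) ≠ 0, 𝔫(Φ₀,Ψ) = 0} = sup {Re⟪f,Tf⟫/‖f‖² : f ∈ S₀, f ≠ 0, ⟪φ,f⟫ = 0}`
(one `Fin 1`-indexed constraint family `Φ` with `Φ 0 = Φ₀`). [cite: ReedSimonIV1978, Thm XIII.1] -/
theorem sSup_constrained_eq (hR : Continuous R) (hRh : ∀ U, (R U)ᴴ = R U)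
    (hRsq : ∀ U, R U * R U = fermionSliceOp U mq)
    (hex : ∀ Ψ : SliceWave Nf S, Continuous Ψ →
      ∃ f : Lp ℂ 2 ((sliceHaar S).prod (Measure.count : Measure J)),
        (f : GaugeConfig 3 S (specialUnitaryGroup (Fin 3) ℂ) × J → ℂ)
          =ᵐ[(sliceHaar S).prod (Measure.count : Measure J)] fun p => (R p.1 *ᵥ Ψ p.1) (e.symm p.2))
    {T : Lp ℂ 2 ((sliceHaar S).prod (Measure.count : Measure J)) →L[ℂ]
      Lp ℂ 2 ((sliceHaar S).prod (Measure.count : Measure J))}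
    (hT : ∀ φ : Lp ℂ 2 ((sliceHaar S).prod (Measure.count : Measure J)),
      (T φ : GaugeConfig 3 S (specialUnitaryGroup (Fin 3) ℂ) × J → ℂ)
        =ᵐ[(sliceHaar S).prod (Measure.count : Measure J)] fun p =>
          ∫ q, (gaugeSliceKernel β p.1 q.1 : ℂ) * (R p.1 * R q.1) (e.symm p.2) (e.symm q.2) * φ q
            ∂((sliceHaar S).prod (Measure.count : Measure J)))
    (Φ : Fin 1 → SliceWave Nf S) (hΦ : Continuous (Φ 0))
    {φ : Lp ℂ 2 ((sliceHaar S).prod (Measure.count : Measure J))}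
    (hφ : (φ : GaugeConfig 3 S (specialUnitaryGroup (Fin 3) ℂ) × J → ℂ)
      =ᵐ[(sliceHaar S).prod (Measure.count : Measure J)] fun p => (R p.1 *ᵥ Φ 0 p.1) (e.symm p.2)) :
    sSup (transferRayleigh β mq '' {Ψ | Ψ ∈ transferCore Nf S ∧ fermionWeightForm mq Ψ Ψ ≠ 0 ∧
        ∀ i, fermionWeightForm mq (Φ i) Ψ = 0}) =
      sSup ((fun f : Lp ℂ 2 ((sliceHaar S).prod (Measure.count : Measure J)) =>
          RCLike.re ⟪f, T f⟫_ℂ / ‖f‖ ^ 2) ''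
        {f | f ∈ {f : Lp ℂ 2 ((sliceHaar S).prod (Measure.count : Measure J)) |
            ∃ Ψ ∈ transferCore Nf S, (f : GaugeConfig 3 S (specialUnitaryGroup (Fin 3) ℂ) × J → ℂ)
              =ᵐ[(sliceHaar S).prod (Measure.count : Measure J)] fun p => (R p.1 *ᵥ Ψ p.1) (e.symm p.2)} ∧
          f ≠ 0 ∧ ⟪φ, f⟫_ℂ = 0}) := by
  rw [rayleigh_image_eq hR hRh hRsq hex hT (fun Ψ => ∀ i, fermionWeightForm mq (Φ i) Ψ = 0)
    (fun f => ⟪φ, f⟫_ℂ = 0) fun Ψ hΨ f hf => by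
      rw [Fin.forall_fin_one,
        inner_embed_eq_fermionWeightForm Nf S mq J e R hR hRh hRsq (Φ 0) Ψ hΦ hΨ.1 φ f hφ hf]]

end EmbeddedLevels

open EmbeddedLevels

/-- **The two top min–max levels of the QCD transfer matrix are the levels of its `L²(sliceHaar ⊗ count)`
realisation** (registered sub-goal `qcdTransferLevel_eq_embedded_levels` of line `pin-the-infimum`): with
`S₀ = {f | ∃ Ψ ∈ core, f = fΨ a.e.}` the embedded core and `T` any bounded operator with the a.e. kernel formula,
`λ₀ = sup {Re⟪f,Tf⟫/‖f‖² : f ∈ S₀, f ≠ 0}` and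
`λ₁ = inf_{φ ∈ S₀} sup {Re⟪f,Tf⟫/‖f‖² : f ∈ S₀, f ≠ 0, ⟪φ,f⟫ = 0}`. [cite: ReedSimonIV1978, Thm XIII.1] -/
theorem qcdTransferLevel_eq_embedded_levels : ∀ (Nf S : ℕ) [NeZero S] (β : ℝ) (mq : Fin Nf → ℝ)
    (J : Type) [Fintype J] [MeasurableSpace J] [MeasurableSingletonClass J]
    (e : Finset (SliceFermiIdx Nf S) ≃ J)
    (R : GaugeConfig 3 S (Matrix.specialUnitaryGroup (Fin 3) ℂ) →
      Matrix (Finset (SliceFermiIdx Nf S)) (Finset (SliceFermiIdx Nf S)) ℂ),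
    Continuous R → (∀ U, (R U)ᴴ = R U) → (∀ U, R U * R U = fermionSliceOp U mq) →
    (∀ Ψ : SliceWave Nf S, Continuous Ψ →
      ∃ f : Lp ℂ 2 ((sliceHaar S).prod (Measure.count : Measure J)),
        (f : GaugeConfig 3 S (Matrix.specialUnitaryGroup (Fin 3) ℂ) × J → ℂ)
          =ᵐ[(sliceHaar S).prod (Measure.count : Measure J)] fun p => (R p.1 *ᵥ Ψ p.1) (e.symm p.2)) →
    ∀ T : Lp ℂ 2 ((sliceHaar S).prod (Measure.count : Measure J)) →L[ℂ]
        Lp ℂ 2 ((sliceHaar S).prod (Measure.count : Measure J)),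
      (∀ φ : Lp ℂ 2 ((sliceHaar S).prod (Measure.count : Measure J)),
        (T φ : GaugeConfig 3 S (Matrix.specialUnitaryGroup (Fin 3) ℂ) × J → ℂ)
          =ᵐ[(sliceHaar S).prod (Measure.count : Measure J)] fun p =>
            ∫ q, (gaugeSliceKernel β p.1 q.1 : ℂ) * (R p.1 * R q.1) (e.symm p.2) (e.symm q.2) * φ q
              ∂((sliceHaar S).prod (Measure.count : Measure J))) →
      qcdTransferLevel Nf S β mq 0 =
          sSup ((fun f : Lp ℂ 2 ((sliceHaar S).prod (Measure.count : Measure J)) =>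
              RCLike.re ⟪f, T f⟫_ℂ / ‖f‖ ^ 2) ''
            {f | f ∈ {f : Lp ℂ 2 ((sliceHaar S).prod (Measure.count : Measure J)) |
                ∃ Ψ ∈ transferCore Nf S, (f : GaugeConfig 3 S (Matrix.specialUnitaryGroup (Fin 3) ℂ) × J → ℂ)
                  =ᵐ[(sliceHaar S).prod (Measure.count : Measure J)] fun p => (R p.1 *ᵥ Ψ p.1) (e.symm p.2)} ∧
              f ≠ 0}) ∧
        qcdTransferLevel Nf S β mq 1 =
          sInf ((fun φ : Lp ℂ 2 ((sliceHaar S).prod (Measure.count : Measure J)) =>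
              sSup ((fun f : Lp ℂ 2 ((sliceHaar S).prod (Measure.count : Measure J)) =>
                  RCLike.re ⟪f, T f⟫_ℂ / ‖f‖ ^ 2) ''
                {f | f ∈ {f : Lp ℂ 2 ((sliceHaar S).prod (Measure.count : Measure J)) |
                    ∃ Ψ ∈ transferCore Nf S,
                      (f : GaugeConfig 3 S (Matrix.specialUnitaryGroup (Fin 3) ℂ) × J → ℂ)
                        =ᵐ[(sliceHaar S).prod (Measure.count : Measure J)] fun p =>
                          (R p.1 *ᵥ Ψ p.1) (e.symm p.2)} ∧
                  f ≠ 0 ∧ ⟪φ, f⟫_ℂ = 0})) ''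
            {f : Lp ℂ 2 ((sliceHaar S).prod (Measure.count : Measure J)) |
              ∃ Ψ ∈ transferCore Nf S, (f : GaugeConfig 3 S (Matrix.specialUnitaryGroup (Fin 3) ℂ) × J → ℂ)
                =ᵐ[(sliceHaar S).prod (Measure.count : Measure J)] fun p => (R p.1 *ᵥ Ψ p.1) (e.symm p.2)}) := by
  intro Nf S _ β mq J _ _ _ e R hR hRh hRsq hex T hT
  refine ⟨?_, ?_⟩
  · -- level `0`: the unconstrained suprema have equal image sets
    rw [qcdTransferLevel_zero]
    have h := rayleigh_image_eq hR hRh hRsq hex hT (fun _ => True) (fun _ => True) fun _ _ _ _ => Iff.rfl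
    simp only [and_true] at h
    rw [h]
  · -- level `1`: `Fin 1`-indexed core constraint families ↔ embedded constraint vectors
    unfold qcdTransferLevel
    congr 1
    refine Set.Subset.antisymm ?_ ?_
    · rintro _ ⟨Φ, hΦ, rfl⟩
      obtain ⟨φ, hφ⟩ := hex (Φ 0) (hΦ 0).1
      exact ⟨φ, ⟨Φ 0, hΦ 0, hφ⟩, (sSup_constrained_eq hR hRh hRsq hex hT Φ (hΦ 0).1 hφ).symm⟩
    · rintro _ ⟨φ, ⟨Ψ₀, hΨ₀, hφ⟩, rfl⟩
      exact ⟨fun _ => Ψ₀, fun _ => hΨ₀, sSup_constrained_eq hR hRh hRsq hex hT (fun _ => Ψ₀) hΨ₀.1 hφ⟩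

end Summit.QuantumFields.QCD.Cruxes.RobustYangMillsHandover.PinTheInfimum

end
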